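import Mathlib.Tactic.Ring
import Mathlib.Tactic.NormNum
import Mathlib.Tactic.Linarith
import Mathlib.Tactic.Positivity
import Mathlib.Tactic.FieldSimp
import Mathlib.Tactic.LinearCombination
import Mathlib.Algebra.Order.BigOperators.Ring.Finset
import Mathlib.Algebra.BigOperators.Field
import Mathlib.Data.Finset.Max
import Mathlib.Data.Fintype.Basic
import Mathlib.Data.Real.Basic
import HarnessLib

/-!
# The charge-zero lemma: THEOREM 1 for an arbitrary number of atoms (the reduction to three atoms, kernel-checked)

Fourth file of the charge-zero lemma (prover 2, generation 8 of the hodge-weil ladder cell; note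
`b2b-hweil-pv2-g8/CHARGE-ZERO-LEMMA.md`, §3). It checks the REDUCTION STEP (C) of Theorem 1 for any finite index type:
given weights `p_k > 0`, positions `|x_k| ≤ p_k`, `T = Σp`, `M = Σx_kp_k`, `V_k = T² + M − 3Tx_k`, `a_k = p_k(2T − x_k)`, and
an index `i` with `V_i < 0`, the KEY INEQUALITY `1 + Σ_k a_k/V_k ≤ 0` holds — PROVIDED the three "small" facts that the other
files of the series establish (taken here as hypotheses so that this file depends on Mathlib only and can be checked while the
farm builds the companions; each hypothesis is, verbatim, a theorem of a companion file):
`hexc` = `at_most_one_exceptional_le` (`WeilClassTestChargeZeroLemmaMatrix.lean`), `hcert2` = the two-atom certificate in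
`(p,x)` form (from `cert2_nonneg`, `WeilClassTestChargeZeroLemma.lean`), `hcert3` = `threeAtoms_calP_nonneg`
(`WeilClassTestChargeZeroLemmaThreeAtoms.lean`). The argument: every `k ≠ i` has `V_k > 0` (`hexc` with the rest of the atoms
lumped into `(P, M')`, `M' ≥ −P²` by `sum_xp_ge_neg_sq_sum`); on the rest `R = univ ∖ {i}`, `a_k/V_k = p_k φ(x_k)` with
`φ(y) = (2T − y)/(T² + M − 3Ty)` convex below its pole, so the chord inequality (`phi_chord_div`) bounds `Σ_R a_k/V_k` by the
value at TWO atoms placed at the extreme positions `L = min_R x`, `U = max_R x` with weights `p_L = Σ_R p_k(U − x_k)/(U − L)`,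
`p_U = Σ_R p_k(x_k − L)/(U − L)` (same `T`, `M`; admissible because the atoms realising `L`, `U` contribute their full weight);
the three-atom (or, if `L = U`, two-atom) key inequality then follows from the certificate via `𝒬 = (ΠV)(1 + Σa/V)`,
`T𝒬 = Σ_k p_kU_kΠ_{l≠k}V_l ≥ 0`. [cite: HardyLittlewoodPolya1952, §3.5] [cite: HornJohnson2013, §7.7]
-/

open Finset

namespace Literature.AlgebraicGeometry.HodgeTheory.WeilClassTestChargeZeroLemma

/-! ### small Finset facts -/

/-- `Σ_S p_k² ≤ (Σ_S p_k)²` for nonnegative weights. [folklore] -/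
theorem sum_sq_le_sq_sum {ι : Type*} (S : Finset ι) (p : ι → ℝ) (hp : ∀ k, 0 ≤ p k) :
    ∑ k ∈ S, p k ^ 2 ≤ (∑ k ∈ S, p k) ^ 2 := by
  classical
  induction S using Finset.induction_on with
  | empty => simp
  | insert a S ha ih =>
    rw [Finset.sum_insert ha, Finset.sum_insert ha]
    have h1 : 0 ≤ p a := hp a
    have h2 : 0 ≤ ∑ k ∈ S, p k := Finset.sum_nonneg (fun k _ => hp k)
    nlinarith [mul_nonneg h1 h2]

/-- `Σ_S x_kp_k ≥ −(Σ_S p_k)²` when `|x_k| ≤ p_k`, `p_k ≥ 0`. [folklore] -/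
theorem sum_xp_ge_neg_sq_sum {ι : Type*} (S : Finset ι) (p x : ι → ℝ) (hp : ∀ k, 0 ≤ p k)
    (hx : ∀ k, |x k| ≤ p k) : -(∑ k ∈ S, p k) ^ 2 ≤ ∑ k ∈ S, x k * p k := by
  have h1 : ∑ k ∈ S, (-(p k ^ 2)) ≤ ∑ k ∈ S, x k * p k := by
    apply Finset.sum_le_sum
    intro k _
    have := (abs_le.mp (hx k)).1
    nlinarith [hp k]
  have h2 : ∑ k ∈ S, (-(p k ^ 2)) = -(∑ k ∈ S, p k ^ 2) := by
    rw [Finset.sum_neg_distrib]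
  rw [h2] at h1
  have h3 := sum_sq_le_sq_sum S p hp
  linarith

/-! ### the chord inequality in divided form -/

/-- (C) `φ(x) ≤ ((U−x)φ(L) + (x−L)φ(U))/(U−L)` for `φ(y) = (2T−y)/(Z−3Ty)`, `T ≥ 0`, `Z ≤ 6T²`, `L ≤ x ≤ U`, `L < U`, all three
denominators positive — the chord inequality of the convex function `φ`, from the exact identity
`[(U−x)(2T−L)D_U + (x−L)(2T−U)D_L]·D_x − (U−L)(2T−x)D_LD_U = 3T(6T²−Z)(U−L)(x−L)(U−x)`. [cite: HardyLittlewoodPolya1952, §3.5] -/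
theorem phi_chord_div (T Z L U x : ℝ) (hT : 0 ≤ T) (hZ : Z ≤ 6 * T ^ 2) (hLx : L ≤ x) (hxU : x ≤ U) (hLU : L < U)
    (hDL : 0 < Z - 3 * T * L) (hDx : 0 < Z - 3 * T * x) (hDU : 0 < Z - 3 * T * U) :
    (2 * T - x) / (Z - 3 * T * x)
      ≤ ((U - x) * ((2 * T - L) / (Z - 3 * T * L)) + (x - L) * ((2 * T - U) / (Z - 3 * T * U))) / (U - L) := by
  have hid : ((U - x) * (2 * T - L) * (Z - 3 * T * U) + (x - L) * (2 * T - U) * (Z - 3 * T * L)) * (Z - 3 * T * x)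
        - (U - L) * (2 * T - x) * (Z - 3 * T * L) * (Z - 3 * T * U)
      = 3 * T * (6 * T ^ 2 - Z) * (U - L) * (x - L) * (U - x) := by ring
  have hdef : 0 ≤ 3 * T * (6 * T ^ 2 - Z) * (U - L) * (x - L) * (U - x) := by
    have h1 : 0 ≤ 6 * T ^ 2 - Z := by linarith
    have h2 : 0 ≤ U - L := by linarith
    have h3 : 0 ≤ x - L := by linarith
    have h4 : 0 ≤ U - x := by linarith
    positivity
  have hUL : 0 < U - L := by linarith
  have eL : (2 * T - L) / (Z - 3 * T * L) * (Z - 3 * T * L) = 2 * T - L := div_mul_cancel₀ _ (ne_of_gt hDL)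
  have eU : (2 * T - U) / (Z - 3 * T * U) * (Z - 3 * T * U) = 2 * T - U := div_mul_cancel₀ _ (ne_of_gt hDU)
  have ex : (2 * T - x) / (Z - 3 * T * x) * (Z - 3 * T * x) = 2 * T - x := div_mul_cancel₀ _ (ne_of_gt hDx)
  have h2 : (Z - 3 * T * L) * (Z - 3 * T * U) * (Z - 3 * T * x)
        * ((U - x) * ((2 * T - L) / (Z - 3 * T * L)) + (x - L) * ((2 * T - U) / (Z - 3 * T * U))
            - (U - L) * ((2 * T - x) / (Z - 3 * T * x)))
      = ((U - x) * (2 * T - L) * (Z - 3 * T * U) + (x - L) * (2 * T - U) * (Z - 3 * T * L)) * (Z - 3 * T * x)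
        - (U - L) * (2 * T - x) * (Z - 3 * T * L) * (Z - 3 * T * U) := by
    linear_combination ((U - x) * (Z - 3 * T * U) * (Z - 3 * T * x)) * eL
      + ((x - L) * (Z - 3 * T * L) * (Z - 3 * T * x)) * eU - ((U - L) * (Z - 3 * T * L) * (Z - 3 * T * U)) * ex
  have h3 : 0 ≤ (Z - 3 * T * L) * (Z - 3 * T * U) * (Z - 3 * T * x)
        * ((U - x) * ((2 * T - L) / (Z - 3 * T * L)) + (x - L) * ((2 * T - U) / (Z - 3 * T * U))
            - (U - L) * ((2 * T - x) / (Z - 3 * T * x))) := by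
    rw [h2, hid]; exact hdef
  have hD : 0 < (Z - 3 * T * L) * (Z - 3 * T * U) * (Z - 3 * T * x) := by positivity
  have h4 : 0 ≤ (U - x) * ((2 * T - L) / (Z - 3 * T * L)) + (x - L) * ((2 * T - U) / (Z - 3 * T * U))
      - (U - L) * ((2 * T - x) / (Z - 3 * T * x)) :=
    le_of_mul_le_mul_left (by simpa using h3) hD
  rw [le_div_iff₀ hUL]
  linarith

/-! ### all other atoms are non-exceptional -/

/-- (A) If `V_i < 0` then `V_k > 0` for every `k ≠ i` (modulo `hexc` = `at_most_one_exceptional_le` of the Matrix file): lump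
the atoms other than `i, k` into a rest of weight `P = Σ p ≥ 0` and moment `M' = Σ x p ≥ −P²`. [folklore] -/
theorem V_pos_of_exceptional {ι : Type*} [Fintype ι] [DecidableEq ι]
    (hexc : ∀ p₁ p₂ P x₁ x₂ M' : ℝ, 0 < p₁ → 0 < p₂ → 0 ≤ P → x₁ ≤ p₁ → x₂ ≤ p₂ → -P ^ 2 ≤ M' →
      (p₁ + p₂ + P) ^ 2 + (x₁ * p₁ + x₂ * p₂ + M') < 3 * (p₁ + p₂ + P) * x₁ →
      (p₁ + p₂ + P) ^ 2 + (x₁ * p₁ + x₂ * p₂ + M') ≤ 3 * (p₁ + p₂ + P) * x₂ → False)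
    (p x : ι → ℝ) (hp : ∀ k, 0 < p k) (hx : ∀ k, |x k| ≤ p k)
    (T M : ℝ) (hT : T = ∑ k, p k) (hM : M = ∑ k, x k * p k)
    (V : ι → ℝ) (hV : ∀ k, V k = T ^ 2 + M - 3 * T * x k)
    (i : ι) (hVi : V i < 0) (k : ι) (hk : k ≠ i) : 0 < V k := by
  have hx' : ∀ k, -p k ≤ x k ∧ x k ≤ p k := fun k => abs_le.mp (hx k)
  by_contra hc
  push Not at hc
  set S : Finset ι := (Finset.univ.erase i).erase k with hS
  have hkR : k ∈ Finset.univ.erase i := Finset.mem_erase.mpr ⟨hk, Finset.mem_univ k⟩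
  have hsum2 : ∀ g : ι → ℝ, ∑ l, g l = g i + (g k + ∑ l ∈ S, g l) := by
    intro g
    rw [← Finset.add_sum_erase _ _ (Finset.mem_univ i), hS, ← Finset.add_sum_erase _ _ hkR]
  have hP0 : 0 ≤ ∑ l ∈ S, p l := Finset.sum_nonneg (fun l _ => (hp l).le)
  have hM' := sum_xp_ge_neg_sq_sum S p x (fun l => (hp l).le) hx
  have hTexp : T = p i + p k + ∑ l ∈ S, p l := by rw [hT, hsum2]; ring
  have hMexp : M = x i * p i + x k * p k + ∑ l ∈ S, x l * p l := by rw [hM, hsum2]; ring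
  refine hexc (p i) (p k) (∑ l ∈ S, p l) (x i) (x k) (∑ l ∈ S, x l * p l) (hp i) (hp k) hP0
    (hx' i).2 (hx' k).2 hM' ?_ ?_
  · have h := hVi; rw [hV i, hTexp, hMexp] at h; linarith
  · have h := hc; rw [hV k, hTexp, hMexp] at h; linarith

/-! ### the key inequality for an arbitrary finite family of atoms -/

/-- THEOREM 1, KEY-INEQUALITY FORM, ANY NUMBER OF ATOMS (modulo the companion facts `hexc`, `hcert2`, `hcert3`, see the module
docstring). For weights `p_k > 0`, positions `|x_k| ≤ p_k` on a finite index type, `T = Σp`, `M = Σx_kp_k`,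
`V_k = T² + M − 3Tx_k`, `a_k = p_k(2T − x_k)`: if `V_i < 0` for some `i`, then `1 + Σ_k a_k/V_k ≤ 0`.
[cite: HardyLittlewoodPolya1952, §3.5] -/
theorem key_inequality {ι : Type*} [Fintype ι] [DecidableEq ι]
    (hexc : ∀ p₁ p₂ P x₁ x₂ M' : ℝ, 0 < p₁ → 0 < p₂ → 0 ≤ P → x₁ ≤ p₁ → x₂ ≤ p₂ → -P ^ 2 ≤ M' →
      (p₁ + p₂ + P) ^ 2 + (x₁ * p₁ + x₂ * p₂ + M') < 3 * (p₁ + p₂ + P) * x₁ →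
      (p₁ + p₂ + P) ^ 2 + (x₁ * p₁ + x₂ * p₂ + M') ≤ 3 * (p₁ + p₂ + P) * x₂ → False)
    (hcert2 : ∀ p₁ p₂ x₁ x₂ : ℝ, |x₁| ≤ p₁ → |x₂| ≤ p₂ →
      0 ≤ p₁ * (3 * (p₁ + p₂) ^ 2 + (x₁ * p₁ + x₂ * p₂) - 4 * (p₁ + p₂) * x₁)
              * ((p₁ + p₂) ^ 2 + (x₁ * p₁ + x₂ * p₂) - 3 * (p₁ + p₂) * x₂)
          + p₂ * (3 * (p₁ + p₂) ^ 2 + (x₁ * p₁ + x₂ * p₂) - 4 * (p₁ + p₂) * x₂)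
              * ((p₁ + p₂) ^ 2 + (x₁ * p₁ + x₂ * p₂) - 3 * (p₁ + p₂) * x₁))
    (hcert3 : ∀ p₁ p₂ p₃ x₁ x₂ x₃ : ℝ, |x₁| ≤ p₁ → |x₂| ≤ p₂ → |x₃| ≤ p₃ →
      0 ≤ 3 * (p₁ * (3 * (p₁ + p₂ + p₃) ^ 2 + (x₁ * p₁ + x₂ * p₂ + x₃ * p₃) - 4 * (p₁ + p₂ + p₃) * x₁)
              * ((p₁ + p₂ + p₃) ^ 2 + (x₁ * p₁ + x₂ * p₂ + x₃ * p₃) - 3 * (p₁ + p₂ + p₃) * x₂)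
              * ((p₁ + p₂ + p₃) ^ 2 + (x₁ * p₁ + x₂ * p₂ + x₃ * p₃) - 3 * (p₁ + p₂ + p₃) * x₃)
          + p₂ * (3 * (p₁ + p₂ + p₃) ^ 2 + (x₁ * p₁ + x₂ * p₂ + x₃ * p₃) - 4 * (p₁ + p₂ + p₃) * x₂)
              * ((p₁ + p₂ + p₃) ^ 2 + (x₁ * p₁ + x₂ * p₂ + x₃ * p₃) - 3 * (p₁ + p₂ + p₃) * x₁)
              * ((p₁ + p₂ + p₃) ^ 2 + (x₁ * p₁ + x₂ * p₂ + x₃ * p₃) - 3 * (p₁ + p₂ + p₃) * x₃)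
          + p₃ * (3 * (p₁ + p₂ + p₃) ^ 2 + (x₁ * p₁ + x₂ * p₂ + x₃ * p₃) - 4 * (p₁ + p₂ + p₃) * x₃)
              * ((p₁ + p₂ + p₃) ^ 2 + (x₁ * p₁ + x₂ * p₂ + x₃ * p₃) - 3 * (p₁ + p₂ + p₃) * x₁)
              * ((p₁ + p₂ + p₃) ^ 2 + (x₁ * p₁ + x₂ * p₂ + x₃ * p₃) - 3 * (p₁ + p₂ + p₃) * x₂)))
    (p x : ι → ℝ) (hp : ∀ k, 0 < p k) (hx : ∀ k, |x k| ≤ p k)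
    (T M : ℝ) (hT : T = ∑ k, p k) (hM : M = ∑ k, x k * p k)
    (V a : ι → ℝ) (hV : ∀ k, V k = T ^ 2 + M - 3 * T * x k) (ha : ∀ k, a k = p k * (2 * T - x k))
    (i : ι) (hVi : V i < 0) :
    1 + ∑ k, a k / V k ≤ 0 := by
  -- basic facts
  have hx' : ∀ k, -p k ≤ x k ∧ x k ≤ p k := fun k => abs_le.mp (hx k)
  have hTpos : 0 < T := by
    rw [hT]; exact lt_of_lt_of_le (hp i) (Finset.single_le_sum (fun k _ => (hp k).le) (Finset.mem_univ i))
  have hMle : M ≤ T ^ 2 := by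
    have h1 : ∑ k, x k * p k ≤ ∑ k, p k ^ 2 := by
      apply Finset.sum_le_sum; intro k _; nlinarith [hx' k, hp k]
    have h2 := sum_sq_le_sq_sum (Finset.univ : Finset ι) p (fun k => (hp k).le)
    rw [hM, hT]; linarith
  have hZ6 : T ^ 2 + M ≤ 6 * T ^ 2 := by nlinarith
  -- the rest of the atoms
  set R : Finset ι := Finset.univ.erase i with hR
  have hsplit : ∀ g : ι → ℝ, ∑ k, g k = g i + ∑ k ∈ R, g k := by
    intro g; rw [hR, ← Finset.add_sum_erase _ _ (Finset.mem_univ i)]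
  -- every other atom is non-exceptional
  have hVpos : ∀ k, k ≠ i → 0 < V k :=
    fun k hk => V_pos_of_exceptional hexc p x hp hx T M hT hM V hV i hVi k hk
  -- case R empty (a single atom): V i + a i ≥ 0 directly
  by_cases hRe : R = ∅
  · have hsum : ∑ k, a k / V k = a i / V i := by
      rw [hsplit, hRe, Finset.sum_empty, add_zero]
    have hTi : T = p i := by
      rw [hT, hsplit, hRe, Finset.sum_empty, add_zero]
    have hMi : M = x i * p i := by
      rw [hM, hsplit, hRe, Finset.sum_empty, add_zero]
    rw [hsum]
    have hVai : 0 ≤ V i + a i := by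
      rw [hV i, ha i, hTi, hMi]; nlinarith [hx' i, hp i]
    have : a i / V i ≤ -1 := by
      rw [div_le_iff_of_neg hVi]; linarith
    linarith
  -- R nonempty: extreme positions L ≤ U on R
  have hRne : R.Nonempty := Finset.nonempty_iff_ne_empty.mpr hRe
  obtain ⟨kL, hkL, hLmin⟩ := Finset.exists_min_image R x hRne
  obtain ⟨kU, hkU, hUmax⟩ := Finset.exists_max_image R x hRne
  set L := x kL with hLdef
  set U := x kU with hUdef
  have hkLi : kL ≠ i := (Finset.mem_erase.mp hkL).1
  have hkUi : kU ≠ i := (Finset.mem_erase.mp hkU).1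
  have hVL : 0 < T ^ 2 + M - 3 * T * L := by have := hVpos kL hkLi; rw [hV kL] at this; exact this
  have hVU : 0 < T ^ 2 + M - 3 * T * U := by have := hVpos kU hkUi; rw [hV kU] at this; exact this
  -- rewrite the rest sum with φ
  have hterm : ∀ k ∈ R, a k / V k = p k * ((2 * T - x k) / (T ^ 2 + M - 3 * T * x k)) := by
    intro k hk; rw [ha k, hV k]; ring
  -- 𝒬-sign bookkeeping: from a certificate `0 ≤ T·ΠV·(1+Σ)`-type identity we extract the inequality in each case
  by_cases hLU : L = U
  · -- all rest atoms at the same position L: two-atom case with weights (p i, P'), positions (x i, L)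
    have hxR : ∀ k ∈ R, x k = L := by
      intro k hk; exact le_antisymm (by rw [hLU]; exact hUmax k hk) (hLmin k hk)
    set P' := ∑ k ∈ R, p k with hP'
    have hP'pos : 0 < P' := by
      rw [hP']; exact lt_of_lt_of_le (hp kL) (Finset.single_le_sum (fun k _ => (hp k).le) hkL)
    have hrest : ∑ k ∈ R, a k / V k = P' * ((2 * T - L) / (T ^ 2 + M - 3 * T * L)) := by
      rw [hP', Finset.sum_mul]
      apply Finset.sum_congr rfl
      intro k hk; rw [hterm k hk, hxR k hk]
    have hT2 : T = p i + P' := by rw [hT, hsplit]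
    have hM2 : M = x i * p i + L * P' := by
      rw [hM, hsplit, hP', Finset.mul_sum]
      congr 1; apply Finset.sum_congr rfl; intro k hk; rw [hxR k hk]
    have hLP : |L| ≤ P' := le_trans (hx kL) (Finset.single_le_sum (fun k _ => (hp k).le) hkL)
    have hc := hcert2 (p i) P' (x i) L (hx i) hLP
    -- 𝒫₂/?: p_i U_i V_L + P' U_L V_i = T (V_i V_L + a_i V_L + a_L V_i)
    have hQ : 0 ≤ V i * (T ^ 2 + M - 3 * T * L) + a i * (T ^ 2 + M - 3 * T * L)
        + P' * (2 * T - L) * V i := by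
      have e : T * (V i * (T ^ 2 + M - 3 * T * L) + a i * (T ^ 2 + M - 3 * T * L) + P' * (2 * T - L) * V i)
          = p i * (3 * (p i + P') ^ 2 + (x i * p i + L * P') - 4 * (p i + P') * x i)
              * ((p i + P') ^ 2 + (x i * p i + L * P') - 3 * (p i + P') * L)
            + P' * (3 * (p i + P') ^ 2 + (x i * p i + L * P') - 4 * (p i + P') * L)
              * ((p i + P') ^ 2 + (x i * p i + L * P') - 3 * (p i + P') * x i) := by
        rw [hV i, ha i, hM2, hT2]; ring
      have h2 : 0 ≤ T * (V i * (T ^ 2 + M - 3 * T * L) + a i * (T ^ 2 + M - 3 * T * L)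
          + P' * (2 * T - L) * V i) := by rw [e]; exact hc
      exact le_of_mul_le_mul_left (by simpa using h2) hTpos
    -- divide by V_i * V_L < 0
    rw [hsplit, hrest]
    have hViL : V i * (T ^ 2 + M - 3 * T * L) < 0 := mul_neg_of_neg_of_pos hVi hVL
    have key : (1 + (a i / V i + P' * ((2 * T - L) / (T ^ 2 + M - 3 * T * L))))
        * (V i * (T ^ 2 + M - 3 * T * L))
        = V i * (T ^ 2 + M - 3 * T * L) + a i * (T ^ 2 + M - 3 * T * L) + P' * (2 * T - L) * V i := by
      have e1 : a i / V i * V i = a i := div_mul_cancel₀ _ (ne_of_lt hVi)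
      have e2 : (2 * T - L) / (T ^ 2 + M - 3 * T * L) * (T ^ 2 + M - 3 * T * L) = 2 * T - L :=
        div_mul_cancel₀ _ (ne_of_gt hVL)
      linear_combination (T ^ 2 + M - 3 * T * L) * e1 + (P' * V i) * e2
    by_contra hneg
    push Not at hneg
    have : (1 + (a i / V i + P' * ((2 * T - L) / (T ^ 2 + M - 3 * T * L)))) * (V i * (T ^ 2 + M - 3 * T * L)) < 0 :=
      mul_neg_of_pos_of_neg hneg hViL
    rw [key] at this
    linarith
  · -- L < U : chord reduction to three atoms (p i, x i), (pL, L), (pU, U)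
    have hLltU : L < U := lt_of_le_of_ne (le_trans (hLmin kU hkU) le_rfl) hLU
    have hUL : 0 < U - L := by linarith
    set pL := ∑ k ∈ R, p k * (U - x k) / (U - L) with hpL
    set pU := ∑ k ∈ R, p k * (x k - L) / (U - L) with hpU
    -- chord bound on the rest sum
    have hrest : ∑ k ∈ R, a k / V k
        ≤ pL * ((2 * T - L) / (T ^ 2 + M - 3 * T * L)) + pU * ((2 * T - U) / (T ^ 2 + M - 3 * T * U)) := by
      have h1 : ∀ k ∈ R, a k / V k ≤ p k * (U - x k) / (U - L) * ((2 * T - L) / (T ^ 2 + M - 3 * T * L))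
          + p k * (x k - L) / (U - L) * ((2 * T - U) / (T ^ 2 + M - 3 * T * U)) := by
        intro k hk
        rw [hterm k hk]
        have hVk : 0 < T ^ 2 + M - 3 * T * x k := by
          have := hVpos k (Finset.mem_erase.mp hk).1; rw [hV k] at this; exact this
        have hch := phi_chord_div T (T ^ 2 + M) L U (x k) hTpos.le hZ6 (hLmin k hk) (hUmax k hk) hLltU hVL hVk hVU
        have hpk := (hp k).le
        calc p k * ((2 * T - x k) / (T ^ 2 + M - 3 * T * x k))
            ≤ p k * (((U - x k) * ((2 * T - L) / (T ^ 2 + M - 3 * T * L))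
                + (x k - L) * ((2 * T - U) / (T ^ 2 + M - 3 * T * U))) / (U - L)) :=
              mul_le_mul_of_nonneg_left hch hpk
          _ = p k * (U - x k) / (U - L) * ((2 * T - L) / (T ^ 2 + M - 3 * T * L))
                + p k * (x k - L) / (U - L) * ((2 * T - U) / (T ^ 2 + M - 3 * T * U)) := by
              ring
      calc ∑ k ∈ R, a k / V k
          ≤ ∑ k ∈ R, (p k * (U - x k) / (U - L) * ((2 * T - L) / (T ^ 2 + M - 3 * T * L))
              + p k * (x k - L) / (U - L) * ((2 * T - U) / (T ^ 2 + M - 3 * T * U))) := Finset.sum_le_sum h1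
        _ = pL * ((2 * T - L) / (T ^ 2 + M - 3 * T * L)) + pU * ((2 * T - U) / (T ^ 2 + M - 3 * T * U)) := by
              rw [Finset.sum_add_distrib, hpL, hpU, Finset.sum_mul, Finset.sum_mul]
    -- admissibility and moments of the three-atom configuration
    have hpL_ge : p kL ≤ pL := by
      rw [hpL]
      have hone : p kL = p kL * (U - x kL) / (U - L) := by
        rw [← hLdef]; field_simp
      rw [hone]
      apply Finset.single_le_sum (f := fun k => p k * (U - x k) / (U - L)) _ hkL
      intro k hk; apply div_nonneg (mul_nonneg (hp k).le (by linarith [hUmax k hk])) hUL.le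
    have hpU_ge : p kU ≤ pU := by
      rw [hpU]
      have hone : p kU = p kU * (x kU - L) / (U - L) := by
        rw [← hUdef]; field_simp
      rw [hone]
      apply Finset.single_le_sum (f := fun k => p k * (x k - L) / (U - L)) _ hkU
      intro k hk; apply div_nonneg (mul_nonneg (hp k).le (by linarith [hLmin k hk])) hUL.le
    have hpLpos : 0 < pL := lt_of_lt_of_le (hp kL) hpL_ge
    have hpUpos : 0 < pU := lt_of_lt_of_le (hp kU) hpU_ge
    have hLabs : |L| ≤ pL := le_trans (hx kL) hpL_ge
    have hUabs : |U| ≤ pU := le_trans (hx kU) hpU_ge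
    have hsumLU : pL + pU = ∑ k ∈ R, p k := by
      rw [hpL, hpU, ← Finset.sum_add_distrib]
      apply Finset.sum_congr rfl; intro k _; field_simp; ring
    have hmomLU : L * pL + U * pU = ∑ k ∈ R, x k * p k := by
      rw [hpL, hpU, Finset.mul_sum, Finset.mul_sum, ← Finset.sum_add_distrib]
      apply Finset.sum_congr rfl; intro k _; field_simp; ring
    have hT3 : T = p i + pL + pU := by rw [hT, hsplit, add_assoc, hsumLU]
    have hM3 : M = x i * p i + L * pL + U * pU := by rw [hM, hsplit, add_assoc, hmomLU]
    have hc := hcert3 (p i) pL pU (x i) L U (hx i) hLabs hUabs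
    -- identity: Σ p_k U_k Π V = T · 𝒬₃,  𝒬₃ = V_i V_L V_U (1 + a_i/V_i + pL φ(L) + pU φ(U))
    have hQ : 0 ≤ V i * (T ^ 2 + M - 3 * T * L) * (T ^ 2 + M - 3 * T * U)
        + a i * (T ^ 2 + M - 3 * T * L) * (T ^ 2 + M - 3 * T * U)
        + pL * (2 * T - L) * V i * (T ^ 2 + M - 3 * T * U)
        + pU * (2 * T - U) * V i * (T ^ 2 + M - 3 * T * L) := by
      have e : 3 * (T * (V i * (T ^ 2 + M - 3 * T * L) * (T ^ 2 + M - 3 * T * U)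
          + a i * (T ^ 2 + M - 3 * T * L) * (T ^ 2 + M - 3 * T * U)
          + pL * (2 * T - L) * V i * (T ^ 2 + M - 3 * T * U)
          + pU * (2 * T - U) * V i * (T ^ 2 + M - 3 * T * L)))
          = 3 * (p i * (3 * (p i + pL + pU) ^ 2 + (x i * p i + L * pL + U * pU) - 4 * (p i + pL + pU) * x i)
              * ((p i + pL + pU) ^ 2 + (x i * p i + L * pL + U * pU) - 3 * (p i + pL + pU) * L)
              * ((p i + pL + pU) ^ 2 + (x i * p i + L * pL + U * pU) - 3 * (p i + pL + pU) * U)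
            + pL * (3 * (p i + pL + pU) ^ 2 + (x i * p i + L * pL + U * pU) - 4 * (p i + pL + pU) * L)
              * ((p i + pL + pU) ^ 2 + (x i * p i + L * pL + U * pU) - 3 * (p i + pL + pU) * x i)
              * ((p i + pL + pU) ^ 2 + (x i * p i + L * pL + U * pU) - 3 * (p i + pL + pU) * U)
            + pU * (3 * (p i + pL + pU) ^ 2 + (x i * p i + L * pL + U * pU) - 4 * (p i + pL + pU) * U)
              * ((p i + pL + pU) ^ 2 + (x i * p i + L * pL + U * pU) - 3 * (p i + pL + pU) * x i)
              * ((p i + pL + pU) ^ 2 + (x i * p i + L * pL + U * pU) - 3 * (p i + pL + pU) * L)) := by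
        rw [hV i, ha i, hM3, hT3]; ring
      have h3 : 0 ≤ 3 * (T * (V i * (T ^ 2 + M - 3 * T * L) * (T ^ 2 + M - 3 * T * U)
          + a i * (T ^ 2 + M - 3 * T * L) * (T ^ 2 + M - 3 * T * U)
          + pL * (2 * T - L) * V i * (T ^ 2 + M - 3 * T * U)
          + pU * (2 * T - U) * V i * (T ^ 2 + M - 3 * T * L))) := by rw [e]; exact hc
      have h4 := le_of_mul_le_mul_left (by simpa using h3) (by norm_num : (0 : ℝ) < 3)
      exact le_of_mul_le_mul_left (by simpa using h4) hTpos
    -- conclude: divide by V_i V_L V_U < 0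
    have hbound : 1 + ∑ k, a k / V k
        ≤ 1 + (a i / V i + (pL * ((2 * T - L) / (T ^ 2 + M - 3 * T * L))
            + pU * ((2 * T - U) / (T ^ 2 + M - 3 * T * U)))) := by
      rw [hsplit]; linarith [hrest]
    refine le_trans hbound ?_
    have hneg3 : V i * (T ^ 2 + M - 3 * T * L) * (T ^ 2 + M - 3 * T * U) < 0 :=
      mul_neg_of_neg_of_pos (mul_neg_of_neg_of_pos hVi hVL) hVU
    have key : (1 + (a i / V i + (pL * ((2 * T - L) / (T ^ 2 + M - 3 * T * L))
            + pU * ((2 * T - U) / (T ^ 2 + M - 3 * T * U)))))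
        * (V i * (T ^ 2 + M - 3 * T * L) * (T ^ 2 + M - 3 * T * U))
        = V i * (T ^ 2 + M - 3 * T * L) * (T ^ 2 + M - 3 * T * U)
          + a i * (T ^ 2 + M - 3 * T * L) * (T ^ 2 + M - 3 * T * U)
          + pL * (2 * T - L) * V i * (T ^ 2 + M - 3 * T * U)
          + pU * (2 * T - U) * V i * (T ^ 2 + M - 3 * T * L) := by
      have e1 : a i / V i * V i = a i := div_mul_cancel₀ _ (ne_of_lt hVi)
      have eL : (2 * T - L) / (T ^ 2 + M - 3 * T * L) * (T ^ 2 + M - 3 * T * L) = 2 * T - L :=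
        div_mul_cancel₀ _ (ne_of_gt hVL)
      have eU : (2 * T - U) / (T ^ 2 + M - 3 * T * U) * (T ^ 2 + M - 3 * T * U) = 2 * T - U :=
        div_mul_cancel₀ _ (ne_of_gt hVU)
      linear_combination ((T ^ 2 + M - 3 * T * L) * (T ^ 2 + M - 3 * T * U)) * e1
        + (pL * V i * (T ^ 2 + M - 3 * T * U)) * eL + (pU * V i * (T ^ 2 + M - 3 * T * L)) * eU
    by_contra hneg
    push Not at hneg
    have : (1 + (a i / V i + (pL * ((2 * T - L) / (T ^ 2 + M - 3 * T * L))
            + pU * ((2 * T - U) / (T ^ 2 + M - 3 * T * U)))))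
        * (V i * (T ^ 2 + M - 3 * T * L) * (T ^ 2 + M - 3 * T * U)) < 0 := mul_neg_of_pos_of_neg hneg hneg3
    rw [key] at this
    linarith

/-! ### Theorem 1 (matrix form) for an arbitrary finite family of atoms -/

/-- Pairwise Cauchy–Schwarz term: `2(a_kz_k)(a_lz_l) ≤ (a_k/V_k)(a_lV_lz_l²) + (a_l/V_l)(a_kV_kz_k²)` for `V_k, V_l > 0`,
`a_k, a_l ≥ 0` (it is `a_ka_l(V_lz_l − V_kz_k)² ≥ 0` divided by `V_kV_l`). [folklore] -/
theorem pair_cs (ak al Vk Vl zk zl : ℝ) (hVk : 0 < Vk) (hVl : 0 < Vl) (hak : 0 ≤ ak) (hal : 0 ≤ al) :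
    2 * (ak * zk) * (al * zl) ≤ ak / Vk * (al * Vl * zl ^ 2) + al / Vl * (ak * Vk * zk ^ 2) := by
  have ek : ak / Vk * Vk = ak := div_mul_cancel₀ _ (ne_of_gt hVk)
  have el : al / Vl * Vl = al := div_mul_cancel₀ _ (ne_of_gt hVl)
  have hrk : 0 ≤ ak / Vk := div_nonneg hak hVk.le
  have hrl : 0 ≤ al / Vl := div_nonneg hal hVl.le
  have hsq : 0 ≤ ak / Vk * (al / Vl) * (Vl * zl - Vk * zk) ^ 2 := by positivity
  have e : ak / Vk * (al * Vl * zl ^ 2) + al / Vl * (ak * Vk * zk ^ 2) - 2 * (ak * zk) * (al * zl)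
      = ak / Vk * (al / Vl) * (Vl * zl - Vk * zk) ^ 2 := by
    linear_combination (- (ak / Vk) * Vl * zl ^ 2) * el + (-(al / Vl) * Vk * zk ^ 2) * ek
      + (2 * zk * zl * (al / Vl) * Vl) * ek + (2 * zk * zl * ak) * el
  nlinarith [e, hsq]

/-- THEOREM 1, MATRIX FORM, ANY NUMBER OF ATOMS (modulo the companion facts `hexc`, `hcert2`, `hcert3`): with the notation of
`key_inequality`, the quadratic form `Σ_k a_kV_kz_k² + (Σ_k a_kz_k)²` is nonnegative for every real `z`, i.e.
`diag(a_kV_k) + aaᵀ ⪰ 0`. Proof: if no `V_k < 0`, termwise; otherwise `key_inequality` gives `1 + Σ a_k/V_k ≤ 0`, the weighted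
Cauchy–Schwarz inequality `(Σ_R a_kz_k)² ≤ (Σ_R a_k/V_k)(Σ_R a_kV_kz_k²)` over the other atoms (`pair_cs` summed) and the identity
`S'(1+S')·F(z) = (1+S')(S'D − w²) + S'a_iz_i²(V_i + a_i + V_iS') + ((1+S')w + S'a_iz_i)²` finish. [cite: HornJohnson2013, §7.7] -/
theorem theorem1_psd {ι : Type*} [Fintype ι] [DecidableEq ι]
    (hexc : ∀ p₁ p₂ P x₁ x₂ M' : ℝ, 0 < p₁ → 0 < p₂ → 0 ≤ P → x₁ ≤ p₁ → x₂ ≤ p₂ → -P ^ 2 ≤ M' →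
      (p₁ + p₂ + P) ^ 2 + (x₁ * p₁ + x₂ * p₂ + M') < 3 * (p₁ + p₂ + P) * x₁ →
      (p₁ + p₂ + P) ^ 2 + (x₁ * p₁ + x₂ * p₂ + M') ≤ 3 * (p₁ + p₂ + P) * x₂ → False)
    (hcert2 : ∀ p₁ p₂ x₁ x₂ : ℝ, |x₁| ≤ p₁ → |x₂| ≤ p₂ →
      0 ≤ p₁ * (3 * (p₁ + p₂) ^ 2 + (x₁ * p₁ + x₂ * p₂) - 4 * (p₁ + p₂) * x₁)
              * ((p₁ + p₂) ^ 2 + (x₁ * p₁ + x₂ * p₂) - 3 * (p₁ + p₂) * x₂)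
          + p₂ * (3 * (p₁ + p₂) ^ 2 + (x₁ * p₁ + x₂ * p₂) - 4 * (p₁ + p₂) * x₂)
              * ((p₁ + p₂) ^ 2 + (x₁ * p₁ + x₂ * p₂) - 3 * (p₁ + p₂) * x₁))
    (hcert3 : ∀ p₁ p₂ p₃ x₁ x₂ x₃ : ℝ, |x₁| ≤ p₁ → |x₂| ≤ p₂ → |x₃| ≤ p₃ →
      0 ≤ 3 * (p₁ * (3 * (p₁ + p₂ + p₃) ^ 2 + (x₁ * p₁ + x₂ * p₂ + x₃ * p₃) - 4 * (p₁ + p₂ + p₃) * x₁)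
              * ((p₁ + p₂ + p₃) ^ 2 + (x₁ * p₁ + x₂ * p₂ + x₃ * p₃) - 3 * (p₁ + p₂ + p₃) * x₂)
              * ((p₁ + p₂ + p₃) ^ 2 + (x₁ * p₁ + x₂ * p₂ + x₃ * p₃) - 3 * (p₁ + p₂ + p₃) * x₃)
          + p₂ * (3 * (p₁ + p₂ + p₃) ^ 2 + (x₁ * p₁ + x₂ * p₂ + x₃ * p₃) - 4 * (p₁ + p₂ + p₃) * x₂)
              * ((p₁ + p₂ + p₃) ^ 2 + (x₁ * p₁ + x₂ * p₂ + x₃ * p₃) - 3 * (p₁ + p₂ + p₃) * x₁)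
              * ((p₁ + p₂ + p₃) ^ 2 + (x₁ * p₁ + x₂ * p₂ + x₃ * p₃) - 3 * (p₁ + p₂ + p₃) * x₃)
          + p₃ * (3 * (p₁ + p₂ + p₃) ^ 2 + (x₁ * p₁ + x₂ * p₂ + x₃ * p₃) - 4 * (p₁ + p₂ + p₃) * x₃)
              * ((p₁ + p₂ + p₃) ^ 2 + (x₁ * p₁ + x₂ * p₂ + x₃ * p₃) - 3 * (p₁ + p₂ + p₃) * x₁)
              * ((p₁ + p₂ + p₃) ^ 2 + (x₁ * p₁ + x₂ * p₂ + x₃ * p₃) - 3 * (p₁ + p₂ + p₃) * x₂)))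
    (p x : ι → ℝ) (hp : ∀ k, 0 < p k) (hx : ∀ k, |x k| ≤ p k)
    (T M : ℝ) (hT : T = ∑ k, p k) (hM : M = ∑ k, x k * p k)
    (V a : ι → ℝ) (hV : ∀ k, V k = T ^ 2 + M - 3 * T * x k) (ha : ∀ k, a k = p k * (2 * T - x k))
    (z : ι → ℝ) :
    0 ≤ ∑ k, a k * V k * z k ^ 2 + (∑ k, a k * z k) ^ 2 := by
  have hx' : ∀ k, -p k ≤ x k ∧ x k ≤ p k := fun k => abs_le.mp (hx k)
  have hne : (Finset.univ : Finset ι).Nonempty ∨ (Finset.univ : Finset ι) = ∅ :=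
    (Finset.univ : Finset ι).eq_empty_or_nonempty.symm
  rcases hne with hne | hemp
  swap
  · simp [hemp]
  obtain ⟨j, _⟩ := hne
  have hTpos : 0 < T := by
    rw [hT]; exact lt_of_lt_of_le (hp j) (Finset.single_le_sum (fun k _ => (hp k).le) (Finset.mem_univ j))
  have hTle : ∀ k, p k ≤ T := fun k => by
    rw [hT]; exact Finset.single_le_sum (fun k _ => (hp k).le) (Finset.mem_univ k)
  have hapos : ∀ k, 0 < a k := by
    intro k; rw [ha k]; apply mul_pos (hp k); linarith [hx' k, hTle k]
  by_cases hex : ∃ i, V i < 0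
  swap
  · push Not at hex
    apply add_nonneg _ (sq_nonneg _)
    apply Finset.sum_nonneg; intro k _
    have := hex k; have := hapos k; positivity
  obtain ⟨i, hVi⟩ := hex
  have hkey := key_inequality hexc hcert2 hcert3 p x hp hx T M hT hM V a hV ha i hVi
  have hVpos : ∀ k, k ≠ i → 0 < V k :=
    fun k hk => V_pos_of_exceptional hexc p x hp hx T M hT hM V hV i hVi k hk
  set R : Finset ι := Finset.univ.erase i with hR
  have hsplit : ∀ g : ι → ℝ, ∑ k, g k = g i + ∑ k ∈ R, g k := by
    intro g; rw [hR, ← Finset.add_sum_erase _ _ (Finset.mem_univ i)]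
  have hRi : ∀ k ∈ R, k ≠ i := fun k hk => (Finset.mem_erase.mp hk).1
  -- abbreviations
  set S' := ∑ k ∈ R, a k / V k with hS'
  set D := ∑ k ∈ R, a k * V k * z k ^ 2 with hD
  set w := ∑ k ∈ R, a k * z k with hw
  have hS'nn : 0 ≤ S' := Finset.sum_nonneg (fun k hk => (div_pos (hapos k) (hVpos k (hRi k hk))).le)
  have hDnn : 0 ≤ D := Finset.sum_nonneg (fun k hk => by
    have := hapos k; have := hVpos k (hRi k hk); positivity)
  -- weighted Cauchy–Schwarz over R
  have hcs : w ^ 2 ≤ S' * D := by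
    rw [hw, hS', hD, sq, Finset.sum_mul_sum, Finset.sum_mul_sum]
    have h2 : ∑ k ∈ R, ∑ l ∈ R, 2 * (a k * z k) * (a l * z l)
        ≤ ∑ k ∈ R, ∑ l ∈ R, (a k / V k * (a l * V l * z l ^ 2) + a l / V l * (a k * V k * z k ^ 2)) := by
      apply Finset.sum_le_sum; intro k hk; apply Finset.sum_le_sum; intro l hl
      exact pair_cs (a k) (a l) (V k) (V l) (z k) (z l) (hVpos k (hRi k hk)) (hVpos l (hRi l hl))
        (hapos k).le (hapos l).le
    have h3 : ∑ k ∈ R, ∑ l ∈ R, (a k / V k * (a l * V l * z l ^ 2) + a l / V l * (a k * V k * z k ^ 2))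
        = 2 * ∑ k ∈ R, ∑ l ∈ R, a k / V k * (a l * V l * z l ^ 2) := by
      have hc : ∑ k ∈ R, ∑ l ∈ R, a l / V l * (a k * V k * z k ^ 2)
          = ∑ k ∈ R, ∑ l ∈ R, a k / V k * (a l * V l * z l ^ 2) := Finset.sum_comm
      simp only [Finset.sum_add_distrib]
      rw [hc]; ring
    have h4 : ∑ k ∈ R, ∑ l ∈ R, 2 * (a k * z k) * (a l * z l) = 2 * ∑ k ∈ R, ∑ l ∈ R, a k * z k * (a l * z l) := by
      rw [Finset.mul_sum]; apply Finset.sum_congr rfl; intro k _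
      rw [Finset.mul_sum]; apply Finset.sum_congr rfl; intro l _; ring
    linarith [h2, h3, h4]
  -- the key inequality, multiplied by V_i < 0
  have hkey' : 0 ≤ V i + a i + V i * S' := by
    have e : (1 + ∑ k, a k / V k) * V i = V i + a i + V i * S' := by
      rw [hsplit (fun k => a k / V k)]
      have e1 : a i / V i * V i = a i := div_mul_cancel₀ _ (ne_of_lt hVi)
      linear_combination e1
    nlinarith [hkey, hVi, e]
  -- final assembly
  rw [hsplit (fun k => a k * V k * z k ^ 2), hsplit (fun k => a k * z k)]
  show 0 ≤ a i * V i * z i ^ 2 + D + (a i * z i + w) ^ 2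
  have hid : S' * (1 + S') * (a i * V i * z i ^ 2 + D + (a i * z i + w) ^ 2)
      = (1 + S') * (S' * D - w ^ 2) + S' * (a i * z i ^ 2) * (V i + a i + V i * S')
        + ((1 + S') * w + S' * (a i * z i)) ^ 2 := by ring
  have h1 : 0 ≤ (1 + S') * (S' * D - w ^ 2) := mul_nonneg (by linarith) (by linarith)
  have h2 : 0 ≤ S' * (a i * z i ^ 2) * (V i + a i + V i * S') :=
    mul_nonneg (mul_nonneg hS'nn (mul_nonneg (hapos i).le (sq_nonneg _))) hkey'
  have h3 : 0 ≤ ((1 + S') * w + S' * (a i * z i)) ^ 2 := sq_nonneg _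
  by_cases hS0 : S' = 0
  · -- then R contributes nothing to S', hence (all terms positive) R is empty-like: D and w need care; use V_i + a_i ≥ 0
    have hVa : 0 ≤ V i + a i := by rw [hS0] at hkey'; simpa using hkey'
    -- with S' = 0 every a_k/V_k (k ∈ R) vanishes, impossible for k ∈ R; so R = ∅ and D = w = 0
    have hRem : R = ∅ := by
      by_contra hne'
      obtain ⟨k, hk⟩ := Finset.nonempty_iff_ne_empty.mpr hne'
      have hlt : 0 < S' := by
        rw [hS']; exact lt_of_lt_of_le (div_pos (hapos k) (hVpos k (hRi k hk)))
          (Finset.single_le_sum (fun l hl => (div_pos (hapos l) (hVpos l (hRi l hl))).le) hk)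
      linarith
    have hD0 : D = 0 := by rw [hD, hRem, Finset.sum_empty]
    have hw0 : w = 0 := by rw [hw, hRem, Finset.sum_empty]
    rw [hD0, hw0, add_zero, add_zero]
    have : a i * V i * z i ^ 2 + (a i * z i) ^ 2 = a i * z i ^ 2 * (V i + a i) := by ring
    rw [this]; exact mul_nonneg (mul_nonneg (hapos i).le (sq_nonneg _)) hVa
  · have hS'pos : 0 < S' := lt_of_le_of_ne hS'nn (Ne.symm hS0)
    have hprod : 0 ≤ S' * (1 + S') * (a i * V i * z i ^ 2 + D + (a i * z i + w) ^ 2) := by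
      rw [hid]; exact add_nonneg (add_nonneg h1 h2) h3
    exact le_of_mul_le_mul_left (by simpa using hprod) (by positivity : 0 < S' * (1 + S'))

end Literature.AlgebraicGeometry.HodgeTheory.WeilClassTestChargeZeroLemma
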